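import Mathlib.NumberTheory.Padics.Complex
import Mathlib.RingTheory.PowerSeries.Basic
import Mathlib.Analysis.SpecificLimits.Normed
import Mathlib.Analysis.Normed.Ring.InfiniteSum
import Mathlib.Analysis.Normed.Group.Ultra
import Mathlib.Analysis.Normed.Ring.Ultra
import Mathlib.Analysis.Real.Sqrt
import HarnessLib

/-!
# Re-centring a bounded `p`-adic power series at a point of the open unit disc (proofs only)

Topic `Literature/NumberTheory/EllipticCurves`, namespace `Literature.NumberTheory.EllipticCurves`.
THEOREMS ONLY (no definition, no named fact; D-0014, D-0026): every statement is an `∃` or a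
`HasSum` between objects the tree already has.

A power series `P = Σ_k P_k T^k ∈ ℚ_p⟦T⟧` with BOUNDED coefficients (`‖P_k‖ ≤ C`; equivalently
`P ∈ Λ ⊗ ℚ_p`, Mazur–Tate–Teitelbaum, Invent. Math. 84 (1986) §I.12) converges on the open unit disc
of `ℂ_p`, and for a CENTRE `a ∈ ℚ_p` with `‖a‖ < 1` the Taylor coefficients at `a`,

  `H_j := Σ_k P_k · (k choose j) · a^{k−j}`  (`= P^{(j)}(a)/j!`, a `p`-adically convergent sum),

form again a series with `‖H_j‖ ≤ C` and `Σ_j H_j z^j = Σ_k P_k (a + z)^k` for every `z ∈ ℂ_p` with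
`‖z‖ < 1` (absolute convergence of the double family `P_k (k choose j) a^{k−j} z^j`, whose terms are
bounded by `C · s^k s^j`, `s² = max(‖a‖, ‖z‖) < 1`, followed by the two iterated summations;
Robert, *A course in p-adic analysis*, Ch. 6 §1.5, and Schikhof, *Ultrametric calculus*, §42: inside
the disc of convergence every point is a centre and the Taylor series at it converges on the same
disc). In particular `H_0 = P(a) = Σ_k P_k a^k` and `H_1 = P′(a) = Σ_k k P_k a^{k−1}`.

Use (cell `bsd-print-cf2`, road (C) of crux stmt-BirchSwinnertonDyer-20368, seat -w8 g21): at
`p = 2` the cyclotomic variable `T ↔ θ(γ) − 1`, `γ = 5`, read on the `χ₈`-coset of an even character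
`θ` is `(χ₈θ)(γ) − 1 = −θ(γ) − 1 = −T − 2` — a translate INSIDE the disc (`‖2‖₂ < 1`). Disegni's
`2`-adic Rankin–Selberg function on the line through `χ₈ ∘ N` is compared with Mazur–Tate–Teitelbaum
`2`-adic `L`-functions read at `−T−2`, i.e. re-centred at `a = −2` and reflected (`T ↦ −T`):
`exists_recenter` / `exists_recenter_sub` supply the re-centred series with its coefficient bound,
its evaluation property on the disc, and its first two coefficients.

What is NOT here: radii other than `1`; several variables; any specific `L`-function.

References: A. M. Robert, *A Course in p-adic Analysis*, GTM 198 (2000), Ch. 6 §1.5 [Robert2000];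
W. H. Schikhof, *Ultrametric calculus*, Cambridge (1984), §42 [Schikhof1984]; B. Mazur, J. Tate,
J. Teitelbaum, Invent. Math. 84 (1986) §I.12 [MazurTateTeitelbaum1986Invent].
-/

noncomputable section

open Filter Topology Finset

namespace Literature.NumberTheory.EllipticCurves

variable {p : ℕ} [Fact p.Prime]

/-! ### Norm estimates for the double family `P_k (k choose j) a^{k−j} z^j` -/

/-- For `j ≤ k`, `0 ≤ s ≤ 1`: `(s²)^k ≤ s^k · s^j`. [folklore] -/
private theorem sq_pow_le_pow_mul_pow_recenter {s : ℝ} (hs0 : 0 ≤ s) (hs1 : s ≤ 1) {k j : ℕ} (hjk : j ≤ k) :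
    (s ^ 2) ^ k ≤ s ^ k * s ^ j := by
  rw [← pow_mul, ← pow_add]
  exact pow_le_pow_of_le_one hs0 hs1 (by omega)

/-- **Termwise bound.** With `‖P_k‖ ≤ C` and `‖a‖, ‖z‖ ≤ s²` (`0 ≤ s ≤ 1`):
`‖P_k (k choose j) a^{k−j} z^j‖ ≤ C · s^k s^j` (the binomial coefficient is an integer, of norm `≤ 1`;
for `j > k` the term is `0`). [cite: Robert2000, Ch. 6 §1.5] -/
private theorem norm_recenterTerm_le {C s : ℝ} (hs0 : 0 ≤ s) (hs1 : s ≤ 1) {P : ℕ → ℂ_[p]}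
    (hP : ∀ k, ‖P k‖ ≤ C) {a z : ℂ_[p]} (ha : ‖a‖ ≤ s ^ 2) (hz : ‖z‖ ≤ s ^ 2) (k j : ℕ) :
    ‖P k * ((k.choose j : ℕ) : ℂ_[p]) * a ^ (k - j) * z ^ j‖ ≤ C * s ^ k * s ^ j := by
  have hC : 0 ≤ C := (norm_nonneg _).trans (hP 0)
  rcases lt_or_ge k j with hkj | hjk
  · rw [Nat.choose_eq_zero_of_lt hkj, Nat.cast_zero, mul_zero, zero_mul, zero_mul, norm_zero]
    exact mul_nonneg (mul_nonneg hC (pow_nonneg hs0 _)) (pow_nonneg hs0 _)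
  · rw [norm_mul, norm_mul, norm_mul, norm_pow, norm_pow]
    have h1 : ‖P k‖ * ‖((k.choose j : ℕ) : ℂ_[p])‖ ≤ C * 1 :=
      mul_le_mul (hP k) (IsUltrametricDist.norm_natCast_le_one ℂ_[p] _) (norm_nonneg _) hC
    have h2 : ‖a‖ ^ (k - j) * ‖z‖ ^ j ≤ (s ^ 2) ^ (k - j) * (s ^ 2) ^ j :=
      mul_le_mul (pow_le_pow_left₀ (norm_nonneg _) ha _) (pow_le_pow_left₀ (norm_nonneg _) hz _)
        (pow_nonneg (norm_nonneg _) _) (pow_nonneg (sq_nonneg _) _)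
    have h3 : (s ^ 2) ^ (k - j) * (s ^ 2) ^ j = (s ^ 2) ^ k := by
      rw [← pow_add, Nat.sub_add_cancel hjk]
    calc ‖P k‖ * ‖((k.choose j : ℕ) : ℂ_[p])‖ * ‖a‖ ^ (k - j) * ‖z‖ ^ j
        = (‖P k‖ * ‖((k.choose j : ℕ) : ℂ_[p])‖) * (‖a‖ ^ (k - j) * ‖z‖ ^ j) := by ring
      _ ≤ (C * 1) * ((s ^ 2) ^ (k - j) * (s ^ 2) ^ j) :=
          mul_le_mul h1 h2 (mul_nonneg (pow_nonneg (norm_nonneg _) _) (pow_nonneg (norm_nonneg _) _))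
            (mul_nonneg hC zero_le_one)
      _ = C * (s ^ 2) ^ k := by rw [mul_one, h3]
      _ ≤ C * (s ^ k * s ^ j) := mul_le_mul_of_nonneg_left (sq_pow_le_pow_mul_pow_recenter hs0 hs1 hjk) hC
      _ = C * s ^ k * s ^ j := by ring

/-- **The double family is summable in `ℂ_p`**: dominated by `C s^k s^j` with
`s = √(max ‖a‖ ‖z‖) < 1`, a product of two geometric series (`ℂ_p` is complete).
[cite: Robert2000, Ch. 6 §1.5] -/
private theorem summable_recenterTerm {C : ℝ} {P : ℕ → ℂ_[p]} (hP : ∀ k, ‖P k‖ ≤ C) {a z : ℂ_[p]}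
    (ha : ‖a‖ < 1) (hz : ‖z‖ < 1) :
    Summable (fun kj : ℕ × ℕ ↦
      P kj.1 * ((kj.1.choose kj.2 : ℕ) : ℂ_[p]) * a ^ (kj.1 - kj.2) * z ^ kj.2) := by
  have hC : 0 ≤ C := (norm_nonneg _).trans (hP 0)
  set r : ℝ := max ‖a‖ ‖z‖ with hr
  have hr0 : 0 ≤ r := le_max_of_le_left (norm_nonneg _)
  have hr1 : r < 1 := max_lt ha hz
  set s : ℝ := Real.sqrt r with hs
  have hs0 : 0 ≤ s := Real.sqrt_nonneg r
  have hs1 : s < 1 := by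
    have h := Real.sqrt_lt_sqrt hr0 hr1
    rwa [Real.sqrt_one] at h
  have hsq : s ^ 2 = r := Real.sq_sqrt hr0
  have ha' : ‖a‖ ≤ s ^ 2 := by rw [hsq]; exact le_max_left _ _
  have hz' : ‖z‖ ≤ s ^ 2 := by rw [hsq]; exact le_max_right _ _
  have hgeom : Summable (fun n : ℕ ↦ s ^ n) := summable_geometric_of_lt_one hs0 hs1
  have hg : Summable (fun kj : ℕ × ℕ ↦ (C * s ^ kj.1) * s ^ kj.2) :=
    Summable.mul_of_nonneg (hgeom.mul_left C) hgeom (fun k ↦ mul_nonneg hC (pow_nonneg hs0 _))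
      (fun j ↦ pow_nonneg hs0 _)
  refine Summable.of_norm_bounded hg fun kj ↦ ?_
  exact norm_recenterTerm_le hs0 hs1.le hP ha' hz' kj.1 kj.2

/-! ### The Taylor coefficients at the centre: convergence and the bound `‖H_j‖ ≤ C` -/

/-- **The `j`-th Taylor coefficient series `Σ_k P_k (k choose j) a^{k−j}` converges in `ℚ_p`**
(terms of norm `≤ C ‖a‖^{k−j} → 0`; `ℚ_p` complete). [cite: Robert2000, Ch. 6 §1.5] -/
theorem summable_coeff_mul_choose_mul_pow {P : PowerSeries ℚ_[p]} {C : ℝ}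
    (hP : ∀ k, ‖PowerSeries.coeff k P‖ ≤ C) {a : ℚ_[p]} (ha : ‖a‖ < 1) (j : ℕ) :
    Summable (fun k : ℕ ↦ PowerSeries.coeff k P * ((k.choose j : ℕ) : ℚ_[p]) * a ^ (k - j)) := by
  have hC : 0 ≤ C := (norm_nonneg _).trans (hP 0)
  have hg : Summable (fun k : ℕ ↦ C * ‖a‖ ^ (k - j)) := by
    have h1 : Summable (fun k : ℕ ↦ C * ‖a‖ ^ k) :=
      (summable_geometric_of_lt_one (norm_nonneg _) ha).mul_left C
    have h2 : Summable (fun k : ℕ ↦ C * ‖a‖ ^ ((k + j) - j)) := by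
      simpa only [Nat.add_sub_cancel] using h1
    exact (summable_nat_add_iff j).mp h2
  refine Summable.of_norm_bounded hg fun k ↦ ?_
  rw [norm_mul, norm_mul, norm_pow]
  calc ‖PowerSeries.coeff k P‖ * ‖((k.choose j : ℕ) : ℚ_[p])‖ * ‖a‖ ^ (k - j)
      ≤ C * 1 * ‖a‖ ^ (k - j) :=
        mul_le_mul (mul_le_mul (hP k) (IsUltrametricDist.norm_natCast_le_one ℚ_[p] _)
          (norm_nonneg _) hC) le_rfl (pow_nonneg (norm_nonneg _) _) (mul_nonneg hC zero_le_one)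
    _ = C * ‖a‖ ^ (k - j) := by rw [mul_one]

/-- **The Taylor coefficients are bounded by the same constant**: `‖Σ_k P_k (k choose j) a^{k−j}‖ ≤ C`
(ultrametric inequality for a convergent sum, each term having norm `≤ C`).
[cite: Robert2000, Ch. 6 §1.5] -/
theorem norm_tsum_coeff_mul_choose_mul_pow_le {P : PowerSeries ℚ_[p]} {C : ℝ}
    (hP : ∀ k, ‖PowerSeries.coeff k P‖ ≤ C) {a : ℚ_[p]} (ha : ‖a‖ < 1) (j : ℕ) :
    ‖∑' k : ℕ, PowerSeries.coeff k P * ((k.choose j : ℕ) : ℚ_[p]) * a ^ (k - j)‖ ≤ C := by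
  have hC : 0 ≤ C := (norm_nonneg _).trans (hP 0)
  refine IsUltrametricDist.norm_tsum_le_of_forall_le_of_nonneg hC fun k ↦ ?_
  rw [norm_mul, norm_mul, norm_pow]
  calc ‖PowerSeries.coeff k P‖ * ‖((k.choose j : ℕ) : ℚ_[p])‖ * ‖a‖ ^ (k - j)
      ≤ C * 1 * 1 :=
        mul_le_mul (mul_le_mul (hP k) (IsUltrametricDist.norm_natCast_le_one ℚ_[p] _)
          (norm_nonneg _) hC) (pow_le_one₀ (norm_nonneg _) ha.le) (pow_nonneg (norm_nonneg _) _)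
          (mul_nonneg hC zero_le_one)
    _ = C := by rw [mul_one, mul_one]

/-! ### The two iterated sums of the double family -/

/-- Row sums: for fixed `k`, `Σ_j P_k (k choose j) a^{k−j} z^j = P_k (a + z)^k` (binomial theorem;
a finite sum). [folklore] -/
private theorem hasSum_recenterRow (P : ℕ → ℂ_[p]) (a z : ℂ_[p]) (k : ℕ) :
    HasSum (fun j : ℕ ↦ P k * ((k.choose j : ℕ) : ℂ_[p]) * a ^ (k - j) * z ^ j)
      (P k * (a + z) ^ k) := by
  have hfin : ∀ j ∉ Finset.range (k + 1),
      P k * ((k.choose j : ℕ) : ℂ_[p]) * a ^ (k - j) * z ^ j = 0 := by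
    intro j hj
    rw [Finset.mem_range, not_lt] at hj
    rw [Nat.choose_eq_zero_of_lt (by omega), Nat.cast_zero, mul_zero, zero_mul, zero_mul]
  have h : HasSum (fun j : ℕ ↦ P k * ((k.choose j : ℕ) : ℂ_[p]) * a ^ (k - j) * z ^ j)
      (∑ j ∈ Finset.range (k + 1), P k * ((k.choose j : ℕ) : ℂ_[p]) * a ^ (k - j) * z ^ j) :=
    hasSum_sum_of_ne_finset_zero hfin
  have hsum : ∑ j ∈ Finset.range (k + 1), P k * ((k.choose j : ℕ) : ℂ_[p]) * a ^ (k - j) * z ^ j =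
      P k * (a + z) ^ k := by
    rw [add_comm a z, add_pow, Finset.mul_sum]
    refine Finset.sum_congr rfl fun j _ ↦ ?_
    ring
  rwa [hsum] at h

/-- Column sums: for fixed `j`, `Σ_k P_k (k choose j) a^{k−j} z^j = ι(H_j) · z^j` where
`H_j = Σ_k P_k (k choose j) a^{k−j}` is summed in `ℚ_p` and `ι : ℚ_p → ℂ_p` (continuous).
[folklore] -/
private theorem hasSum_recenterCol {P : PowerSeries ℚ_[p]} {C : ℝ} (hP : ∀ k, ‖PowerSeries.coeff k P‖ ≤ C)
    {a : ℚ_[p]} (ha : ‖a‖ < 1) (z : ℂ_[p]) (j : ℕ) :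
    HasSum (fun k : ℕ ↦ algebraMap ℚ_[p] ℂ_[p] (PowerSeries.coeff k P) *
        ((k.choose j : ℕ) : ℂ_[p]) * (algebraMap ℚ_[p] ℂ_[p] a) ^ (k - j) * z ^ j)
      (algebraMap ℚ_[p] ℂ_[p]
          (∑' k : ℕ, PowerSeries.coeff k P * ((k.choose j : ℕ) : ℚ_[p]) * a ^ (k - j)) * z ^ j) := by
  have hs := (summable_coeff_mul_choose_mul_pow hP ha j).hasSum
  have hmap := hs.map (algebraMap ℚ_[p] ℂ_[p]) (continuous_algebraMap ℚ_[p] ℂ_[p])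
  have hmul := hmap.mul_right (z ^ j)
  refine hmul.congr_fun fun k ↦ ?_
  simp only [Function.comp_apply, map_mul, map_pow, map_natCast]

/-! ### Main statements -/

/-- **Re-centring a bounded series at `a` (`‖a‖ < 1`).** For `P ∈ ℚ_p⟦T⟧` with `‖P_k‖ ≤ C` there is
`H ∈ ℚ_p⟦T⟧` (its Taylor expansion at `a`) with: (i) `‖H_j‖ ≤ C`; (ii) `H_j = Σ_k P_k (k choose j)
a^{k−j}` (as a `HasSum` in `ℚ_p`); (iii) for every `z ∈ ℂ_p`, `‖z‖ < 1`:
`Σ_j ι(H_j) z^j = Σ_k ι(P_k) (ι a + z)^k` (`ι : ℚ_p → ℂ_p`), the right-hand side converging.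
[cite: Robert2000, Ch. 6 §1.5] [cite: Schikhof1984, §42] -/
theorem exists_recenter {P : PowerSeries ℚ_[p]} {C : ℝ} (hP : ∀ k, ‖PowerSeries.coeff k P‖ ≤ C)
    {a : ℚ_[p]} (ha : ‖a‖ < 1) :
    ∃ H : PowerSeries ℚ_[p],
      (∀ j, ‖PowerSeries.coeff j H‖ ≤ C) ∧
      (∀ j, HasSum (fun k : ℕ ↦ PowerSeries.coeff k P * ((k.choose j : ℕ) : ℚ_[p]) * a ^ (k - j))
        (PowerSeries.coeff j H)) ∧
      ∀ z : ℂ_[p], ‖z‖ < 1 →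
        Summable (fun k : ℕ ↦ algebraMap ℚ_[p] ℂ_[p] (PowerSeries.coeff k P) *
          (algebraMap ℚ_[p] ℂ_[p] a + z) ^ k) ∧
        HasSum (fun j : ℕ ↦ algebraMap ℚ_[p] ℂ_[p] (PowerSeries.coeff j H) * z ^ j)
          (∑' k : ℕ, algebraMap ℚ_[p] ℂ_[p] (PowerSeries.coeff k P) *
            (algebraMap ℚ_[p] ℂ_[p] a + z) ^ k) := by
  set H : PowerSeries ℚ_[p] := PowerSeries.mk fun j ↦
    ∑' k : ℕ, PowerSeries.coeff k P * ((k.choose j : ℕ) : ℚ_[p]) * a ^ (k - j) with hH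
  have hcoeff : ∀ j, PowerSeries.coeff j H =
      ∑' k : ℕ, PowerSeries.coeff k P * ((k.choose j : ℕ) : ℚ_[p]) * a ^ (k - j) := fun j ↦ by
    rw [hH, PowerSeries.coeff_mk]
  refine ⟨H, fun j ↦ ?_, fun j ↦ ?_, fun z hz ↦ ?_⟩
  · rw [hcoeff]
    exact norm_tsum_coeff_mul_choose_mul_pow_le hP ha j
  · rw [hcoeff]
    exact (summable_coeff_mul_choose_mul_pow hP ha j).hasSum
  · -- the double family over `ℂ_p`, with `Q_k := ι(P_k)` (made opaque) and centre `b := ι(a)`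
    obtain ⟨Q, hQ⟩ : ∃ Q : ℕ → ℂ_[p], ∀ k, Q k = algebraMap ℚ_[p] ℂ_[p] (PowerSeries.coeff k P) :=
      ⟨_, fun _ ↦ rfl⟩
    obtain ⟨b, hb⟩ : ∃ b : ℂ_[p], b = algebraMap ℚ_[p] ℂ_[p] a := ⟨_, rfl⟩
    have hb1 : ‖b‖ < 1 := by rw [hb, norm_algebraMap']; exact ha
    have hQ' : ∀ k, ‖Q k‖ ≤ C := fun k ↦ by rw [hQ, norm_algebraMap']; exact hP k
    obtain ⟨S, hFS⟩ := summable_recenterTerm hQ' hb1 hz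
    -- rows: `Σ_k Q_k (b + z)^k = S`
    have hrows : HasSum (fun k : ℕ ↦ Q k * (b + z) ^ k) S :=
      hFS.prod_fiberwise fun k ↦ hasSum_recenterRow Q b z k
    -- columns: `Σ_j ι(H_j) z^j = S`
    have hswap := (Equiv.prodComm ℕ ℕ).hasSum_iff.mpr hFS
    have hcols : HasSum (fun j : ℕ ↦ algebraMap ℚ_[p] ℂ_[p] (PowerSeries.coeff j H) * z ^ j) S := by
      refine hswap.prod_fiberwise fun j ↦ ?_
      have hc := hasSum_recenterCol hP ha z j
      rw [← hcoeff j] at hc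
      refine hc.congr_fun fun k ↦ ?_
      simp only [Function.comp_apply, Equiv.prodComm_apply, Prod.swap_prod_mk, hQ, hb]
    have heq : (fun k : ℕ ↦ algebraMap ℚ_[p] ℂ_[p] (PowerSeries.coeff k P) *
        (algebraMap ℚ_[p] ℂ_[p] a + z) ^ k) = fun k : ℕ ↦ Q k * (b + z) ^ k := by
      funext k; rw [hQ, hb]
    rw [heq]
    refine ⟨hrows.summable, ?_⟩
    rwa [hrows.tsum_eq]

/-- **The constant and linear Taylor coefficients**: in the situation of `exists_recenter` (any `H`
satisfying (ii)), `H_0 = Σ_k P_k a^k` and `H_1 = Σ_k k · P_k a^{k−1}` (value and derivative of `P`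
at the centre). [cite: Robert2000, Ch. 6 §1.5] -/
theorem coeff_zero_one_of_hasSum_recenter {P H : PowerSeries ℚ_[p]} {a : ℚ_[p]}
    (hH : ∀ j, HasSum (fun k : ℕ ↦ PowerSeries.coeff k P * ((k.choose j : ℕ) : ℚ_[p]) * a ^ (k - j))
      (PowerSeries.coeff j H)) :
    HasSum (fun k : ℕ ↦ PowerSeries.coeff k P * a ^ k) (PowerSeries.coeff 0 H) ∧
      HasSum (fun k : ℕ ↦ PowerSeries.coeff k P * (k : ℚ_[p]) * a ^ (k - 1))
        (PowerSeries.coeff 1 H) := by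
  constructor
  · refine (hH 0).congr_fun fun k ↦ ?_
    rw [Nat.choose_zero_right, Nat.cast_one, mul_one, Nat.sub_zero]
  · refine (hH 1).congr_fun fun k ↦ ?_
    rw [Nat.choose_one_right]

/-- **Re-centring followed by the reflection `T ↦ −T`.** For `P ∈ ℚ_p⟦T⟧` with `‖P_k‖ ≤ C` and
`a ∈ ℚ_p`, `‖a‖ < 1`, there is `H ∈ ℚ_p⟦T⟧` with `‖H_j‖ ≤ C`,
`Σ_j ι(H_j) z^j = Σ_k ι(P_k) (ι a − z)^k` for all `z ∈ ℂ_p` with `‖z‖ < 1` (i.e. "`H(T) = P(a − T)`"),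
`H_0 = Σ_k P_k a^k = P(a)` and `H_1 = −Σ_k k P_k a^{k−1} = −P′(a)`. At `p = 2`, `a = −2` this is
`H(T) = P(−T−2)`, the reading of a Mazur–Tate–Teitelbaum series on the `χ₈`-coset of the cyclotomic
line (`(χ₈θ)(5) − 1 = −(θ(5) − 1) − 2`). [cite: Robert2000, Ch. 6 §1.5] [cite: Schikhof1984, §42]
[cite: MazurTateTeitelbaum1986Invent, §I.12–I.13] -/
theorem exists_recenter_sub {P : PowerSeries ℚ_[p]} {C : ℝ} (hP : ∀ k, ‖PowerSeries.coeff k P‖ ≤ C)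
    {a : ℚ_[p]} (ha : ‖a‖ < 1) :
    ∃ H : PowerSeries ℚ_[p],
      (∀ j, ‖PowerSeries.coeff j H‖ ≤ C) ∧
      HasSum (fun k : ℕ ↦ PowerSeries.coeff k P * a ^ k) (PowerSeries.coeff 0 H) ∧
      HasSum (fun k : ℕ ↦ -(PowerSeries.coeff k P * (k : ℚ_[p]) * a ^ (k - 1)))
        (PowerSeries.coeff 1 H) ∧
      ∀ z : ℂ_[p], ‖z‖ < 1 →
        Summable (fun k : ℕ ↦ algebraMap ℚ_[p] ℂ_[p] (PowerSeries.coeff k P) *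
          (algebraMap ℚ_[p] ℂ_[p] a - z) ^ k) ∧
        HasSum (fun j : ℕ ↦ algebraMap ℚ_[p] ℂ_[p] (PowerSeries.coeff j H) * z ^ j)
          (∑' k : ℕ, algebraMap ℚ_[p] ℂ_[p] (PowerSeries.coeff k P) *
            (algebraMap ℚ_[p] ℂ_[p] a - z) ^ k) := by
  obtain ⟨H₀, hbd, hcoef, heval⟩ := exists_recenter hP ha
  obtain ⟨h0, h1⟩ := coeff_zero_one_of_hasSum_recenter hcoef
  refine ⟨PowerSeries.rescale (-1) H₀, fun j ↦ ?_, ?_, ?_, fun z hz ↦ ?_⟩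
  · rw [PowerSeries.coeff_rescale, norm_mul, norm_pow, norm_neg, norm_one, one_pow, one_mul]
    exact hbd j
  · rw [PowerSeries.coeff_rescale, pow_zero, one_mul]
    exact h0
  · rw [PowerSeries.coeff_rescale, pow_one, neg_one_mul]
    exact h1.neg
  · have hz' : ‖-z‖ < 1 := by rwa [norm_neg]
    obtain ⟨hsum, hval⟩ := heval (-z) hz'
    simp only [← sub_eq_add_neg] at hsum hval
    refine ⟨hsum, ?_⟩
    refine hval.congr_fun fun j ↦ ?_
    rw [PowerSeries.coeff_rescale, map_mul, map_pow, map_neg, map_one, neg_pow z]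
    ring

end Literature.NumberTheory.EllipticCurves

end
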